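import Literature.NumberTheory.NumberFields.NFIsoMemP
import HarnessLib

/-!
# Number fields: "easy to compare, hard to name" — the `PEq` witness and the canonical-form glue
# (Blass–Gurevich 1984; Fortnow–Grochow 2011; Landau 1985 / A. K. Lenstra 1983 / H. W. Lenstra 1992)

Proved glue (no new notions, no facts) joining the tree's theorem "number-field isomorphism is in
`P`" (`nfIso_mem_P_holds`, `NFIsoMemP.lean`; Landau 1985, A. K. Lenstra 1983 Thm. (3.7), H. W.
Lenstra 1992 §2.9) to the Blass–Gurevich / Fortnow–Grochow classes of equivalence problems
(`EquivalenceProblems.lean`: `PEq`, `CF(FP)`), in the INLINED shapes used by route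
`PneNP/CanonicalForms` (decls `NumberFieldNoCF`, `NFIsoPEq`, `PEqNotCF` of
`Summits/PneNP/PneNP/Theses/CanonicalForms.lean`; compare `canonicalForm_of_P_eq_NP` in
`EquivalenceProblems.lean`, the same service for that route's `CanonOfPEqNP`):

* `nfIsoPEq_witness` — there is a relation on bit strings, pointwise "both strings are codes of
  monic irreducible integer polynomials with `ℚ`-isomorphic stem fields, or neither is such a
  code", which is an equivalence relation with pair-language in `P` (witness `nfEquiv`;
  Lenstra 1992, §2.9: "given two number fields … one can decide whether or not they are
  isomorphic … in polynomial time");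
* `pEq_not_CF_of_noCanonicalDefiningPoly` — if NO `FP` map sends (the code of) every monic
  irreducible `p` to (the code of) a defining polynomial of a field isomorphic to `ℚ[X]/(p)`
  coherently across the isomorphism class ("number fields have no polynomial-time canonical
  defining polynomial" — OPEN; Cohen GTM 138 §4.4.2: `polred` is only "almost canonical"), then that
  `PEq` relation has no `FP` canonical form, so `CF(FP) ≠ PEq` in the sense of Fortnow–Grochow
  2011, §1 ("our first guiding question": which of `LexEq ⊆ CF ⊆ Ker ⊆ PEq` are proper). The proof
  is the observation that an `FP` canonical form of that relation, restricted to codes of monic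
  irreducible polynomials, IS a polynomial-time canonical defining polynomial (decoding by
  `ofCoeffsAsc_coeffsAsc`).

Nothing here asserts the open hypothesis; the second theorem is an implication.

## References

* L. Fortnow, J. A. Grochow, *Complexity classes of equivalence problems revisited*, Inform.
  Comput. 209 (2011) 748–763 = arXiv:0907.4775, §1. [FortnowGrochow2011]
* A. Blass, Y. Gurevich, *Equivalence relations, invariants, and normal forms*, SIAM J. Comput.
  13 (1984) 682–689. [BlassGurevich1984]
* S. Landau, *Factoring polynomials over algebraic number fields*, SIAM J. Comput. 14 (1985)
  184–195. [Landau1985]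
* H. W. Lenstra Jr., *Algorithms in algebraic number theory*, Bull. AMS 26 (1992) 211–244, §2.9.
  [Lenstra1992]
* H. Cohen, *A Course in Computational Algebraic Number Theory*, GTM 138, §4.4.2, §4.5.4. [Cohen1993]
-/

open Polynomial

namespace Literature.NumberTheory.NumberFields

open _root_.Computability Literature.Computability.Complexity

/-- **Number-field isomorphism is a `P`-decidable equivalence relation (a `PEq` witness), in the
inlined shape of route PneNP/CanonicalForms (decl `NFIsoPEq`)**: some relation `E` on bit strings —
pointwise: both strings are codes of monic irreducible `p, q ∈ ℤ[X]` with
`ℚ[X]/(p) ≃ₐ[ℚ] ℚ[X]/(q)`, or neither string is such a code — is an equivalence relation whose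
pair-language `{⟨x, y⟩ | E x y}` is in `P`. Witness `E := nfEquiv` (`nfEquiv_equivalence`,
`pairLang_nfEquiv_mem_P nfIso_mem_P_holds`). [cite: Lenstra1992, §2.9] [cite: Landau1985, main theorem p. 184] -/
theorem nfIsoPEq_witness :
    ∃ E : List Bool → List Bool → Prop, (∀ x y : List Bool, E x y ↔ ((∃ p q : Polynomial ℤ, Literature.Computability.Complexity.encodingIntBool.listBool.encode ((List.range (p.natDegree + 1)).map p.coeff) = x ∧ Literature.Computability.Complexity.encodingIntBool.listBool.encode ((List.range (q.natDegree + 1)).map q.coeff) = y ∧ (p.Monic ∧ Irreducible p) ∧ (q.Monic ∧ Irreducible q) ∧ Nonempty (AdjoinRoot (p.map (Int.castRingHom ℚ)) ≃ₐ[ℚ] AdjoinRoot (q.map (Int.castRingHom ℚ)))) ∨ ((¬ ∃ p : Polynomial ℤ, (p.Monic ∧ Irreducible p) ∧ Literature.Computability.Complexity.encodingIntBool.listBool.encode ((List.range (p.natDegree + 1)).map p.coeff) = x) ∧ ¬ ∃ q : Polynomial ℤ, (q.Monic ∧ Irreducible q) ∧ Literature.Computability.Complexity.encodingIntBool.listBool.encode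 ((List.range (q.natDegree + 1)).map q.coeff) = y))) ∧ Equivalence E ∧ ({w | ∃ x y, w = Literature.Computability.Complexity.boolPair x y ∧ E x y} : Language Bool) ∈ Literature.Computability.Complexity.Classes.P := by
  refine ⟨nfEquiv, fun x y => ?_, nfEquiv_equivalence, pairLang_nfEquiv_mem_P nfIso_mem_P_holds⟩
  show boolPair x y ∈ nfIsoLang ∨ (x ∉ monicIrredLang ∧ y ∉ monicIrredLang) ↔ _
  rw [boolPair_mem_nfIsoLang_iff]
  exact Iff.rfl

/-- **"Hard to name ∧ easy to compare ⟹ `CF(FP) ≠ PEq`" for number fields**, in the inlined shapes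
of route PneNP/CanonicalForms (`NumberFieldNoCF → NFIsoPEq → PEqNotCF`): if no `c ∈ FP` maps the
code of every monic irreducible `p ∈ ℤ[X]` to the code of a monic irreducible polynomial defining a
`ℚ`-isomorphic field, coherently across the isomorphism class, then the `PEq` relation of
`nfIsoPEq_witness`-shape has no `FP` canonical form: an `FP` canonical form `c` for it sends the code
of `p` to an equivalent string, i.e. (invalid strings being a class of their own) to the code of some
monic irreducible `p'` with `ℚ[X]/(p') ≅ ℚ[X]/(p)`, read back by `decode (code p') = coeffsAsc p'`,
`∑_{i<|l|} lᵢ Xⁱ = ofCoeffsAsc l`, `ofCoeffsAsc (coeffsAsc p') = p'`; and `c` is constant on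
isomorphism classes. This is the elementary half of Fortnow–Grochow's guiding question `CF` vs
`PEq` applied to the number-field relation; the hypothesis is open.
[cite: FortnowGrochow2011, §1 (CF ⊆ Ker ⊆ PEq; guiding question)] [cite: Lenstra1992, §2.9] -/
theorem pEq_not_CF_of_noCanonicalDefiningPoly :
    (¬ ∃ c ∈ Literature.Computability.Complexity.FP, (∀ p : Polynomial ℤ, p.Monic → Irreducible p → ∃ l : List ℤ, Literature.Computability.Complexity.encodingIntBool.listBool.decode (c (Literature.Computability.Complexity.encodingIntBool.listBool.encode ((List.range (p.natDegree + 1)).map p.coeff))) = some l ∧ (∑ i : Fin l.length, Polynomial.monomial (i : ℕ) (l.get i)).Monic ∧ Irreducible (∑ i : Fin l.length, Polynomial.monomial (i : ℕ) (l.get i)) ∧ Nonempty (AdjoinRoot (((∑ i : Fin l.length, Polynomial.monomial (i : ℕ) (l.get i))).map (Int.castRingHom ℚ)) ≃ₐ[ℚ] AdjoinRoot ((p).map (Int.castRingHom ℚ)))) ∧ ∀ p q : Polynomial ℤ, p.Monic → Irreducible p → q.Monic → Irreducible q → Nonempty (AdjoinRoot ((p).map (Int.castRingHom ℚ)) ≃ₐ[ℚ]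 AdjoinRoot ((q).map (Int.castRingHom ℚ))) → c (Literature.Computability.Complexity.encodingIntBool.listBool.encode ((List.range (p.natDegree + 1)).map p.coeff)) = c (Literature.Computability.Complexity.encodingIntBool.listBool.encode ((List.range (q.natDegree + 1)).map q.coeff))) →
    (∃ E : List Bool → List Bool → Prop, (∀ x y : List Bool, E x y ↔ ((∃ p q : Polynomial ℤ, Literature.Computability.Complexity.encodingIntBool.listBool.encode ((List.range (p.natDegree + 1)).map p.coeff) = x ∧ Literature.Computability.Complexity.encodingIntBool.listBool.encode ((List.range (q.natDegree + 1)).map q.coeff) = y ∧ (p.Monic ∧ Irreducible p) ∧ (q.Monic ∧ Irreducible q) ∧ Nonempty (AdjoinRoot (p.map (Int.castRingHom ℚ)) ≃ₐ[ℚ] AdjoinRoot (q.map (Int.castRingHom ℚ)))) ∨ ((¬ ∃ p : Polynomial ℤ, (p.Monic ∧ Irreducible p) ∧ Literature.Computability.Complexity.encodingIntBool.listBool.encode ((List.range (p.natDegree + 1)).map p.coeff) = x) ∧ ¬ ∃ q : Polynomial ℤ, (q.Monic ∧ Irreducible q) ∧ Literature.Computability.Complexity.encodingIntBool.listBool.encode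 ((List.range (q.natDegree + 1)).map q.coeff) = y))) ∧ Equivalence E ∧ ({w | ∃ x y, w = Literature.Computability.Complexity.boolPair x y ∧ E x y} : Language Bool) ∈ Literature.Computability.Complexity.Classes.P) →
    ∃ E : List Bool → List Bool → Prop, Equivalence E ∧ ({w | ∃ x y, w = Literature.Computability.Complexity.boolPair x y ∧ E x y} : Language Bool) ∈ Literature.Computability.Complexity.Classes.P ∧ ¬ ∃ c ∈ Literature.Computability.Complexity.FP, (∀ x, E (c x) x) ∧ ∀ x y, E x y → c x = c y := by
  intro hT hB
  obtain ⟨E, hEiff, hEq, hEP⟩ := hB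
  refine ⟨E, hEq, hEP, ?_⟩
  rintro ⟨c, hcFP, hc1, hc2⟩
  apply hT
  refine ⟨c, hcFP, ?_, ?_⟩
  · intro p hpm hpi
    have hx := hc1 (encodingIntPoly.encode p)
    rw [hEiff] at hx
    rcases hx with ⟨p', q, hp', hq, hp'mi, -, hiso⟩ | ⟨-, hno⟩
    · have hqp : q = p := encodingIntPoly_encode_injective hq
      subst hqp
      refine ⟨coeffsAsc p', ?_, ?_, ?_, ?_⟩
      · change encodingIntBool.listBool.decode (c (encodingIntPoly.encode q)) = some (coeffsAsc p')
        rw [← listBool_decode_encodingIntPoly_encode p']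
        exact congrArg _ hp'.symm
      · change (ofCoeffsAsc (coeffsAsc p')).Monic
        rw [ofCoeffsAsc_coeffsAsc]
        exact hp'mi.1
      · change Irreducible (ofCoeffsAsc (coeffsAsc p'))
        rw [ofCoeffsAsc_coeffsAsc]
        exact hp'mi.2
      · change Nonempty (AdjoinRoot ((ofCoeffsAsc (coeffsAsc p')).map (Int.castRingHom ℚ)) ≃ₐ[ℚ]
          AdjoinRoot (q.map (Int.castRingHom ℚ)))
        rw [ofCoeffsAsc_coeffsAsc]
        exact hiso
    · exact absurd ⟨p, ⟨hpm, hpi⟩, rfl⟩ hno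
  · intro p q hpm hpi hqm hqi hiso
    apply hc2
    rw [hEiff]
    exact Or.inl ⟨p, q, rfl, rfl, ⟨hpm, hpi⟩, ⟨hqm, hqi⟩, hiso⟩

/-- **Corollary (the unconditional bridge)**: "number fields have no polynomial-time canonical
defining polynomial" implies `CF(FP) ≠ PEq` (inlined shapes `NumberFieldNoCF → PEqNotCF` of route
PneNP/CanonicalForms), by `nfIsoPEq_witness`. [cite: FortnowGrochow2011, §1 (guiding question)] [cite: Lenstra1992, §2.9] -/
theorem pEq_not_CF_of_noCanonicalDefiningPoly' (h : ¬ ∃ c ∈ Literature.Computability.Complexity.FP, (∀ p : Polynomial ℤ, p.Monic → Irreducible p → ∃ l : List ℤ, Literature.Computability.Complexity.encodingIntBool.listBool.decode (c (Literature.Computability.Complexity.encodingIntBool.listBool.encode ((List.range (p.natDegree + 1)).map p.coeff))) = some l ∧ (∑ i : Fin l.length, Polynomial.monomial (i : ℕ) (l.get i)).Monic ∧ Irreducible (∑ i : Fin l.length, Polynomial.monomial (i : ℕ) (l.get i)) ∧ Nonempty (AdjoinRoot (((∑ i : Fin l.length, Polynomial.monomial (i : ℕ) (l.get i))).map (Int.castRingHom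 ℚ)) ≃ₐ[ℚ] AdjoinRoot ((p).map (Int.castRingHom ℚ)))) ∧ ∀ p q : Polynomial ℤ, p.Monic → Irreducible p → q.Monic → Irreducible q → Nonempty (AdjoinRoot ((p).map (Int.castRingHom ℚ)) ≃ₐ[ℚ] AdjoinRoot ((q).map (Int.castRingHom ℚ))) → c (Literature.Computability.Complexity.encodingIntBool.listBool.encode ((List.range (p.natDegree + 1)).map p.coeff)) = c (Literature.Computability.Complexity.encodingIntBool.listBool.encode ((List.range (q.natDegree + 1)).map q.coeff))) :
    ∃ E : List Bool → List Bool → Prop, Equivalence E ∧ ({w | ∃ x y, w = Literature.Computability.Complexity.boolPair x y ∧ E x y} : Language Bool) ∈ Literature.Computability.Complexity.Classes.P ∧ ¬ ∃ c ∈ Literature.Computability.Complexity.FP, (∀ x, E (c x) x) ∧ ∀ x y, E x y → c x = c y :=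
  pEq_not_CF_of_noCanonicalDefiningPoly h nfIsoPEq_witness

end Literature.NumberTheory.NumberFields
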